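import Literature.Computability.QuantumComplexity.EvenSVTDegreeBookkeeping
import Literature.Computability.QuantumComplexity.SketchMedianBoost
import HarnessLib

/-!
# Even polynomial singular value transformation from `SQ_φ(A)` and `SQ_{φ_b}(b)`: the
# end-to-end nested SAMPLE statement with explicit polynomial thresholds (CGLLTW 2022,
# Theorem 3.4, even case), Frobenius form — and the typed residue of that currency

Chia, Gilyén, Li, Lin, Tang, Wang, J. ACM 69(5):33 (2022) = arXiv:1910.06151 (bib
`ChiaEtAl2022`), §3.3, proof of Theorem 3.4, even case (held arXiv text p. 20 L65 – p. 21 L22;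
`d` = the polynomial degree, the print's `1/δ` factors elided as "…"): "by (thm:evenSing), we
can get `R ∈ ℂ^{r×n}` and `C ∈ ℂ^{r×c}` such that `‖R†f̄(CC†)R + f(0)I − f(A†A)‖ ≤ ε`, where
`r = Õ(d⁴‖A‖²‖A‖_F²/ε² …)` and `c = Õ(d⁸‖A‖⁶‖A‖_F²/ε² …)` … This reduces the problem to
approximating `R†f̄(CC†)Rb + f(0)b`.  We further approximate `Rb ≈ u ∈ ℂ^r` such that
`‖Rb − u‖ ≤ ε/d`.  Using (prop:appr-mms), this needs `Õ(‖A‖_F²‖b‖²d²/ε² …)` samples … This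
suffices to maintain the error bound because
`‖R†f̄(CC†)(Rb − u)‖ ≤ ‖R†√f̄(CC†)‖‖√f̄(CC†)‖‖Rb − u‖ ≤ √(‖f(A†A) − f(0)I‖ + ε)·√(max f̄)·ε/d
≲ ε` … As a consequence, `v := R†f̄(CC†)u + f(0)b` satisfies `‖v − p(A)b‖ ≤ ε`."

This module JOINS the tree's pieces of that proof into ONE nested statement over the sample
spaces, from the accesses `SQ_φ(A)`, `SQ_{φ_b}(b)` to the output vector, with every threshold an
explicit polynomial in `d = 2k`, `φ`, `φ_b`, `‖A‖_F`, `1/ε`, `1/η`, `log(1/δ)`, `log(1/δ')`: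

* the MATRIX stage is the tree's `EvenPolySVT.even_polynomial_svt` (`EvenSVTDegreeBookkeeping`:
  `s ≥ 8φ²(2k)⁴‖A‖_F⁴log(6/δ)/ε²`, `s ≥ 2φ²log(3/δ)`, `c ≥ 8φ⁶(2k)⁸‖A‖_F⁸log(6/δ)/ε²`, two-stage
  mass `> 1 − δ` of `‖R_ωᵀ q̄_clamp(CCᵀ) R_ω + q(0)I − q(AᵀA)‖_F ≤ ε`), used BY NAME;
* the VECTOR stage is the tree's boosted `EvenPolySVT.Output.output_error_mass_center`
  (`SketchMedianBoost`: `t ≥ 8 ln(1/δ')` independent copies of the `σ`-sample `u ≈ R_ω b`, a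
  Euclidean centre kept, per-copy threshold `σ ≥ 36φ_b‖R_ω‖_F²‖R_ωᵀM‖_F²/η²`), used BY NAME for
  EVERY outcome `(ω, τ)` of the matrix stage;
* §1 supplies the one new inequality that makes the vector threshold OUTCOME-FREE:
  `frobSq_mul_cfc_le` — for real symmetric `H` and `|g| ≤ B`, `‖X·g(H)‖_F² ≤ B²‖X‖_F²` (spectral
  theorem `cfc g H = U diag(g∘λ) Uᵀ`, two orthogonal invariances of the rectangular Frobenius
  norm, one column scaling; no matrix-norm instance) — the Frobenius-currency surrogate of
  "`‖XM‖ ≤ ‖X‖‖M‖_op`, `‖g(H)‖_op ≤ max|g|`";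
* §2 sizes the vector step: `|q̄_clamp| ≤ 2k²` (the tree's Markov bound `abs_eval_divX_le`), so
  `‖R_ωᵀM_{ω,τ}‖_F² ≤ (2k²)²‖R_ω‖_F²`, and with the tree's `frobSq_sketch_mul_le`
  (`‖R_ω‖_F² ≤ φ‖A‖_F²`) the uniform threshold **`σ ≥ 144φ²φ_b k⁴‖A‖_F⁴/η²`**;
* §3 `nested_mass_three_stage` is the finite-sum union bound nesting the three stages;
* §4 **`even_polynomial_svt_end_to_end`**: three-stage nested mass `> 1 − δ − δ'` of
  `‖(R_ωᵀ M_{ω,τ} u_* + q(0)b) − q(AᵀA)b‖ ≤ (ε + η)‖b‖`, for every centre-selector family (one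
  exists: `exists_centerSelector_family`); `…_normalised`: the same under the print's `‖A‖_F ≤ 1`;
* §5 `vector_stage_sample_display`: the vector stage draws `t·σ = 72φ²φ_b d⁴‖A‖_F⁴ℓ'/η²` samples
  of `SQ(b)` — degree exponent `4` in this currency.

TYPED RESIDUE (what the Frobenius currency does not reach, said once and precisely).  The print's
count for the vector step is `≍ φ‖A‖_F²‖b‖²d²/ε²` — degree exponent `2` — because it reads the
matrix-level event in OPERATOR norm: `‖R†√f̄(CC†)‖² = ‖R†f̄(CC†)R‖ ≤ ‖f(A†A) − f(0)I‖ + ε ≤ 2 + ε`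
(p. 21 L16–19), which absorbs `R` entirely, and pays only `‖√f̄‖ ≤ √(max f̄) ≲ d`.  In the tree's
toolbox the matrix event is a FROBENIUS-norm event and no operator norm of `R_ωᵀM` is available;
the surrogate `‖R_ωᵀM‖_F ≤ 2k²‖R_ω‖_F ≤ 2k²√φ‖A‖_F` costs the extra `d²` and `φ‖A‖_F²`.  Closing
the gap needs exactly one operator-norm layer (`‖Xv‖ ≤ ‖X‖_op‖v‖` for the sketch products and an
operator-norm matrix stage) — not formalised here.  Either way the vector stage is subdominant:
the stage-(2) sketch alone has `s·c = 2⁶φ⁸d¹²‖A‖_F¹²log²(6/δ)/ε⁴` entries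
(`threshold_entry_count_display`).

SCOPE (honest).  Finite sums of sampling weights (`iidWeight`) over the cell's own sketch
estimators; SAMPLE counts only — no algorithm, data structure, running time or query model is
formalised; `SQ` access to the output is the tree's `Output.outputWitness` (Lemma "sample-Mv",
`EvenSVTOutputAccess`), not restated; Euclidean error against `‖b‖` (the print rescales
`ε ← ε‖p(A)b‖`); constants explicit, not optimised; the odd case (`p(x) = x·q(x²)`) is not
treated.  Nothing in this module bears on `BQP` vs `BPP`: it is bookkeeping of a classical
sampling argument under a stated access model.
-/

noncomputable section

open scoped Matrix
open Polynomial Finset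

namespace Literature.Computability.QuantumComplexity.SampleQuery.EvenPolySVT

/-! ### §1 The spectral surrogate: `‖X·g(H)‖_F ≤ sup|g| · ‖X‖_F` without a norm instance -/

section spectral

variable {a s t : ℕ}

/-- `‖X‖_F² = tr(X Xᵀ)`. [folklore] -/
private theorem frobSq_eq_trace_mul_transpose (X : Matrix (Fin a) (Fin s) ℝ) :
    frobSq X = Matrix.trace (X * Xᵀ) := by
  simp [frobSq_eq_sum_sq, Matrix.trace, Matrix.mul_apply, pow_two]

/-- Right multiplication by a co-isometry `V` (`V Vᵀ = 1`; e.g. an orthogonal matrix or its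
transpose) preserves the Frobenius norm of a RECTANGULAR matrix: `‖Y V‖_F = ‖Y‖_F`
(`tr(YV(YV)ᵀ) = tr(Y VVᵀ Yᵀ) = tr(Y Yᵀ)`).  The tree's `Matrix.frobSqNorm_mul_unitary`
(`HoffmanWielandt.lean`) is the square case. [cite: HornJohnson2013, §5.6, text before Theorem
5.6.34 (unitarily invariant norms, `‖A‖ = ‖UAV‖`; held 2012 printing p. 448 L30)] -/
theorem frobSq_mul_eq_of_mul_transpose_eq_one (Y : Matrix (Fin a) (Fin s) ℝ)
    (V : Matrix (Fin s) (Fin t) ℝ) (hV : V * Vᵀ = 1) : frobSq (Y * V) = frobSq Y := by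
  rw [frobSq_eq_trace_mul_transpose, frobSq_eq_trace_mul_transpose, Matrix.transpose_mul,
    Matrix.mul_assoc, ← Matrix.mul_assoc V, hV, Matrix.one_mul]

/-- Column scaling: `‖Y · diag(v)‖_F² ≤ B² ‖Y‖_F²` when every `|v j| ≤ B`. [folklore] -/
private theorem frobSq_mul_diagonal_le (Y : Matrix (Fin a) (Fin s) ℝ) (v : Fin s → ℝ) {B : ℝ}
    (hv : ∀ j, |v j| ≤ B) : frobSq (Y * Matrix.diagonal v) ≤ B ^ 2 * frobSq Y := by
  rw [frobSq_eq_sum_sq, frobSq_eq_sum_sq, mul_sum]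
  refine sum_le_sum fun i _ => ?_
  rw [mul_sum]
  refine sum_le_sum fun j _ => ?_
  rw [Matrix.mul_diagonal, mul_pow]
  have hB : v j ^ 2 ≤ B ^ 2 := by
    rw [← sq_abs (v j)]
    exact pow_le_pow_left₀ (abs_nonneg _) (hv j) 2
  nlinarith [sq_nonneg (Y i j)]

/-- **Frobenius surrogate of the operator norm for functions of a symmetric matrix.**  For a real
symmetric `H ∈ ℝ^{s×s}`, a real function `g` with `|g| ≤ B` everywhere, and ANY `X ∈ ℝ^{a×s}`:
`‖X · g(H)‖_F² ≤ B² ‖X‖_F²`, where `g(H) = cfc g H = U·diag(g∘λ)·Uᵀ` is Mathlib's continuous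
functional calculus (spectral theorem `Matrix.IsHermitian.cfc_eq`); proof = two orthogonal
invariances and one column scaling.  This is the inequality `‖X g(H)‖_F ≤ ‖g(H)‖·‖X‖_F` with
`‖g(H)‖ ≤ max|g|`, stated with NO matrix-norm instance — the one place an OPERATOR norm of the
print enters this file's bookkeeping, in Frobenius-compatible form.  Tight: `H = 0`, `g ≡ B`.
[cite: ChiaEtAl2022, §3.3 proof of Theorem 3.4 (even case, the vector step:
"`‖√f̄(CC†)‖ ≤ √(max_x f̄(x))`", held arXiv text p. 21 L14–19); HornJohnson2013, §5.6
Problem 5.6.P20 (`‖AB‖₂ ≤ ‖A‖₂ |||B|||₂`, Frobenius vs spectral norm; held 2012 printing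
p. 457 L15)] -/
theorem frobSq_mul_cfc_le (X : Matrix (Fin a) (Fin s) ℝ) {H : Matrix (Fin s) (Fin s) ℝ}
    (hH : H.IsHermitian) (g : ℝ → ℝ) {B : ℝ} (hg : ∀ x, |g x| ≤ B) :
    frobSq (X * cfc g H) ≤ B ^ 2 * frobSq X := by
  classical
  set U : Matrix (Fin s) (Fin s) ℝ := (hH.eigenvectorUnitary : Matrix (Fin s) (Fin s) ℝ) with hU
  have hU1 : U * Uᵀ = 1 := by
    have h := Unitary.coe_mul_star_self hH.eigenvectorUnitary
    simpa [hU, Matrix.star_eq_conjTranspose, Matrix.conjTranspose_eq_transpose_of_trivial] using h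
  have hU2 : Uᵀ * Uᵀᵀ = 1 := by
    have h := Unitary.coe_star_mul_self hH.eigenvectorUnitary
    simpa [hU, Matrix.star_eq_conjTranspose, Matrix.conjTranspose_eq_transpose_of_trivial] using h
  have hcfc : cfc g H = U * Matrix.diagonal (g ∘ hH.eigenvalues) * Uᵀ := by
    rw [hH.cfc_eq, Matrix.IsHermitian.cfc, Unitary.conjStarAlgAut_apply]
    simp [hU, Matrix.star_eq_conjTranspose, Matrix.conjTranspose_eq_transpose_of_trivial]
  rw [hcfc, ← Matrix.mul_assoc, ← Matrix.mul_assoc,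
    frobSq_mul_eq_of_mul_transpose_eq_one _ _ hU2]
  calc frobSq (X * U * Matrix.diagonal (g ∘ hH.eigenvalues))
      ≤ B ^ 2 * frobSq (X * U) := frobSq_mul_diagonal_le _ _ fun j => hg _
    _ = B ^ 2 * frobSq X := by rw [frobSq_mul_eq_of_mul_transpose_eq_one _ _ hU1]

end spectral

/-! ### §2 Sizing the vector step uniformly over the sketch outcomes -/

section sizing

variable {m n s c : ℕ}

/-- `clamp01 y ∈ [0,1]` (file-private in `EvenSVTDegreeBookkeeping`; re-derived). [folklore] -/
private theorem clamp01_mem_Icc (y : ℝ) : clamp01 y ∈ Set.Icc (0 : ℝ) 1 :=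
  ⟨le_max_left _ _, max_le zero_le_one (min_le_right _ _)⟩

/-- **`max |q̄_clamp| ≤ 2k²M`** on all of `ℝ`: the clamped `q̄ = (q − q(0))/y` of a polynomial `q`
with `deg q ≤ k`, `|q| ≤ M` on `[0,1]` is bounded by `2k²M = d²M/2` (`d = 2k`) — the tree's Markov
bound `abs_eval_divX_le` BY NAME composed with the clamp.  Tight up to the constant for
`q = T_k(2x − 1)` (`chebyshev_shifted_tight`).  This is the print's "`max_x f̄(x) ≲ d²`" of the
vector step. [cite: ChiaEtAl2022, §3.3 Lemma (low-degree polynomials are smooth) ("`max |q̄(x)|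
≲ d²`", held arXiv text p. 20 L58–63) and proof of Theorem 3.4 (even case, p. 21 L18)] -/
theorem abs_qbarClamp_le {k : ℕ} {q : ℝ[X]} (hq : q.natDegree ≤ k) {M : ℝ}
    (hq1 : ∀ y ∈ Set.Icc (0 : ℝ) 1, |q.eval y| ≤ M) (y : ℝ) :
    |qbarClamp q y| ≤ 2 * (k : ℝ) ^ 2 * M :=
  abs_eval_divX_le hq hq1 (clamp01_mem_Icc y)

/-- **The kernel factor of the vector step, Frobenius surrogate:** for ANY `R ∈ ℝ^{s×n}`, ANY
`B ∈ ℝ^{c×s}` and the clamped kernel `M = q̄_clamp(BᵀB)` of the even construction: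
`‖RᵀM‖_F² ≤ (2k²M₀)² ‖R‖_F²` (`|q| ≤ M₀` on `[0,1]`) — `frobSq_mul_cfc_le` at the symmetric Gram
matrix `BᵀB` with `abs_qbarClamp_le`.  (The print's operator-norm route
`‖R†√f̄(CC†)‖‖√f̄(CC†)‖` is sharper: the typed residue of the module docstring.)
[cite: ChiaEtAl2022, §3.3 proof of Theorem 3.4 (even case, "`‖R†f̄(CC†)(Rb − u)‖ ≤
‖R†√f̄(CC†)‖‖√f̄(CC†)‖‖Rb − u‖`", held arXiv text p. 21 L14–19)] -/
theorem frobSq_transpose_mul_kernel_le {k : ℕ} {q : ℝ[X]} (hq : q.natDegree ≤ k) {M₀ : ℝ}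
    (hq1 : ∀ y ∈ Set.Icc (0 : ℝ) 1, |q.eval y| ≤ M₀) (R : Matrix (Fin s) (Fin n) ℝ)
    (B : Matrix (Fin c) (Fin s) ℝ) :
    frobSq (Rᵀ * cfc (qbarClamp q) (Bᵀ * B)) ≤ (2 * (k : ℝ) ^ 2 * M₀) ^ 2 * frobSq R := by
  have hH : (Bᵀ * B).IsHermitian := by
    simpa [Matrix.conjTranspose_eq_transpose_of_trivial] using
      Matrix.isHermitian_conjTranspose_mul_self B
  rw [← frobSq_transpose R]
  exact frobSq_mul_cfc_le Rᵀ hH (qbarClamp q) (abs_qbarClamp_le hq hq1)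

/-- **Uniform per-copy threshold for the vector step.**  If `‖R‖_F² ≤ φ‖A‖_F²` (every row sketch
of `SQ_φ(A)`: the tree's `frobSq_sketch_mul_le`) and `‖RᵀM‖_F² ≤ (2k²)²‖R‖_F²`
(`frobSq_transpose_mul_kernel_le` at `M₀ = 1`), then the boosted vector step's per-copy
hypothesis `36φ_b‖R‖_F²‖RᵀM‖_F²/η² ≤ σ` (tree `output_error_mass_center`) follows from the
OUTCOME-FREE threshold **`σ ≥ 144 φ² φ_b k⁴ ‖A‖_F⁴ / η²`** (`= 9φ²φ_b d⁴‖A‖_F⁴/η²`, `d = 2k`).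
[cite: ChiaEtAl2022, §3.3 proof of Theorem 3.4 (even case, vector step sample count "using that
`‖R‖_F ≲ ‖A‖_F`", held arXiv text p. 21 L12–13)] -/
theorem vector_step_threshold_of_uniform {k σ : ℕ} {φ φb η F : ℝ} {R : Matrix (Fin s) (Fin n) ℝ}
    {RM : Matrix (Fin n) (Fin s) ℝ} (hφb : 0 ≤ φb) (hη : 0 < η)
    (hR : frobSq R ≤ φ * F) (hRM : frobSq RM ≤ (2 * (k : ℝ) ^ 2 * 1) ^ 2 * frobSq R)
    (hσL : 144 * φ ^ 2 * φb * (k : ℝ) ^ 4 * F ^ 2 / η ^ 2 ≤ σ) :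
    36 * φb * frobSq R * frobSq RM / η ^ 2 ≤ σ := by
  have hR0 : 0 ≤ frobSq R := frobSq_nonneg R
  refine le_trans ?_ hσL
  rw [div_le_div_iff_of_pos_right (by positivity)]
  calc 36 * φb * frobSq R * frobSq RM
      ≤ 36 * φb * frobSq R * ((2 * (k : ℝ) ^ 2 * 1) ^ 2 * frobSq R) :=
        mul_le_mul_of_nonneg_left hRM (by positivity)
    _ = 144 * φb * (k : ℝ) ^ 4 * (frobSq R * frobSq R) := by ring
    _ ≤ 144 * φb * (k : ℝ) ^ 4 * (φ * F * (φ * F)) :=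
        mul_le_mul_of_nonneg_left (mul_le_mul hR hR hR0 (hR0.trans hR)) (by positivity)
    _ = 144 * φ ^ 2 * φb * (k : ℝ) ^ 4 * F ^ 2 := by ring

end sizing

/-! ### §3 Nesting three sampling stages -/

/-- **Three-stage nesting of sample-space masses (bookkeeping).**  Outer two-stage weights
`w₁ ≥ 0`, `w₂ ≥ 0` with event `E` of nested mass `> 1 − δ`; an independent third stage `w₃ ≥ 0`
whose event `G a b` has mass `≥ 1 − δ'` whenever `b ∈ E a`; and `G a b ⊆ Good a b` on `E`.  Then
the three-stage nested mass of `Good` exceeds `1 − δ − δ'` (`δ > 0`, `δ' ≥ 0`; via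
`(1 − δ')(1 − δ) ≥ 1 − δ − δ'`) — the printed proof's union bound, as finite sums.
[cite: ChiaEtAl2022, §3.3 proof of Theorem 3.4 (each step "with probability `≥ 1 − δ`", p. 21)] -/
theorem nested_mass_three_stage {α β γ : Type*} [Fintype α] [Fintype β] [Fintype γ]
    {w₁ : α → ℝ} {w₂ : α → β → ℝ} {w₃ : γ → ℝ} (hw₁ : ∀ a, 0 ≤ w₁ a)
    (hw₂ : ∀ a b, 0 ≤ w₂ a b) (hw₃ : ∀ g, 0 ≤ w₃ g) {E : α → Finset β}
    {G Good : α → β → Finset γ} {δ δ' : ℝ} (hδ : 0 < δ) (hδ' : 0 ≤ δ')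
    (hout : 1 - δ < ∑ a, w₁ a * ∑ b ∈ E a, w₂ a b)
    (hin : ∀ a, ∀ b ∈ E a, 1 - δ' ≤ ∑ g ∈ G a b, w₃ g)
    (hsub : ∀ a, ∀ b ∈ E a, G a b ⊆ Good a b) :
    1 - δ - δ' < ∑ a, w₁ a * ∑ b, w₂ a b * ∑ g ∈ Good a b, w₃ g := by
  classical
  have hnonneg : 0 ≤ ∑ a, w₁ a * ∑ b, w₂ a b * ∑ g ∈ Good a b, w₃ g :=
    sum_nonneg fun a _ => mul_nonneg (hw₁ a) (sum_nonneg fun b _ =>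
      mul_nonneg (hw₂ a b) (sum_nonneg fun g _ => hw₃ g))
  rcases le_or_gt (1 - δ') 0 with hneg | hpos
  · linarith
  have hstep : (1 - δ') * ∑ a, w₁ a * ∑ b ∈ E a, w₂ a b ≤
      ∑ a, w₁ a * ∑ b, w₂ a b * ∑ g ∈ Good a b, w₃ g := by
    rw [mul_sum]
    refine sum_le_sum fun a _ => ?_
    rw [mul_left_comm]
    refine mul_le_mul_of_nonneg_left ?_ (hw₁ a)
    rw [mul_sum]
    calc ∑ b ∈ E a, (1 - δ') * w₂ a b
        ≤ ∑ b ∈ E a, w₂ a b * ∑ g ∈ Good a b, w₃ g := sum_le_sum fun b hb => by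
          rw [mul_comm]
          exact mul_le_mul_of_nonneg_left ((hin a b hb).trans
            (sum_le_sum_of_subset_of_nonneg (hsub a b hb) fun g _ _ => hw₃ g)) (hw₂ a b)
      _ ≤ ∑ b, w₂ a b * ∑ g ∈ Good a b, w₃ g :=
          sum_le_sum_of_subset_of_nonneg (subset_univ _) fun b _ _ =>
            mul_nonneg (hw₂ a b) (sum_nonneg fun g _ => hw₃ g)
  have hprod : (1 - δ') * (1 - δ) < (1 - δ') * ∑ a, w₁ a * ∑ b ∈ E a, w₂ a b :=
    mul_lt_mul_of_pos_left hout hpos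
  nlinarith

/-! ### §4 The end-to-end statement -/

section endToEnd

variable {m n s c σ t : ℕ} {φ : ℝ} {A : Matrix (Fin m) (Fin n) ℝ}

/-- `spec(AᵀA) ⊆ [0, ‖A‖_F²]` (eigenvalues of the PSD Gram matrix are `≥ 0` and sum to
`tr(AᵀA) = ‖A‖_F²`); file-private in `EvenSVTDegreeBookkeeping`, re-derived. [folklore] -/
private theorem spectrum_gram_le_frobSq' (A : Matrix (Fin m) (Fin n) ℝ) {x : ℝ}
    (hx : x ∈ spectrum ℝ (Aᵀ * A)) : x ≤ frobSq A := by
  classical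
  have hP : (Aᵀ * A).PosSemidef := by
    simpa [Matrix.conjTranspose_eq_transpose_of_trivial] using
      Matrix.posSemidef_conjTranspose_mul_self A
  rw [hP.1.spectrum_real_eq_range_eigenvalues] at hx
  obtain ⟨i, rfl⟩ := hx
  have htr : (Aᵀ * A).trace = ∑ j, hP.1.eigenvalues j := by
    simpa using hP.1.trace_eq_sum_eigenvalues
  have htr' : (Aᵀ * A).trace = frobSq A := by
    simp only [Matrix.trace, Matrix.diag_apply, Matrix.mul_apply, Matrix.transpose_apply,
      frobSq_eq_sum_sq, pow_two]
    exact Finset.sum_comm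
  calc hP.1.eigenvalues i ≤ ∑ j, hP.1.eigenvalues j :=
        Finset.single_le_sum (fun j _ => hP.eigenvalues_nonneg j) (Finset.mem_univ i)
    _ = frobSq A := by rw [← htr, htr']

/-- **The selector hypothesis is satisfiable**: a family of Euclidean-centre selectors, one per
row outcome `ω`, exists as soon as `t ≥ 1` (tree `exists_centerSelector`); the end-to-end theorem
holds for EVERY such family (e.g. the print-style `j*(ε_*)` of Minsker's Remark 3.2).
[cite: Minsker2015, §3 Remark 3.2] -/
theorem exists_centerSelector_family (W : MatrixOversamplingWitness φ A) (b : Fin n → ℝ)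
    (pb : Fin n → ℝ) (ht : 0 < t) :
    ∃ sel : (Fin s → Fin m) → (Fin t → (Fin σ → Fin n)) → Fin t, ∀ ω ξ,
      IsCenter Output.vecDist
        (fun i => Output.matVecEst (sketch (rowDist W.tilde) ω * A) b pb (ξ i)) (sel ω ξ) :=
  ⟨fun ω => (exists_centerSelector Output.vecDist
      (Output.matVecEst (sketch (rowDist W.tilde) ω * A) b pb) ht).choose,
    fun ω => (exists_centerSelector Output.vecDist
      (Output.matVecEst (sketch (rowDist W.tilde) ω * A) b pb) ht).choose_spec⟩

/-- **Even polynomial SVT from `SQ_φ(A)` and `SQ_{φ_b}(b)` to the output vector — the nested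
SAMPLE statement with every threshold an explicit polynomial (CGLLTW Theorem 3.4, even case,
Frobenius form).**  Data: `SQ_φ(A)` with `‖A‖ ≤ 1` (`spec(AᵀA) ⊆ [0,1]`), `SQ_{φ_b}(b)`, `b ≠ 0`,
a polynomial `q` with `deg q ≤ k`, `|q| ≤ 1` on `[0,1]` (`p(x) = q(x²)`, `d = 2k`,
`p^{(SV)}(A) = q(AᵀA)`), accuracies `ε, η > 0`, failure budgets `δ ∈ (0,1]`, `δ' > 0`.  Stages:
(1) `s` row samples `ω` of `A` from `rowDist W̃` (`R_ω = S_ω A`); (2) `c` column samples `τ` of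
`R̃_ω` (`C = R_ω T_τᵀ`, kernel `M_{ω,τ} = q̄_clamp(CCᵀ)`); (3) `t` independent copies of the
`σ`-sample estimator `u ≈ R_ω b` from `SQ(b)` (tree `matVecEst`), of which a EUCLIDEAN CENTRE
`u_* = u_{sel}` is kept (tree `IsCenter`; every centre selector works, one exists by
`exists_centerSelector`).  THRESHOLDS: `s ≥ 8φ²(2k)⁴‖A‖_F⁴log(6/δ)/ε²`, `s ≥ 2φ²log(3/δ)`,
`c ≥ 8φ⁶(2k)⁸‖A‖_F⁸log(6/δ)/ε²` (the tree's `even_polynomial_svt`, verbatim),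
**`σ ≥ 144φ²φ_b k⁴‖A‖_F⁴/η²`** per copy and **`t ≥ 8 ln(1/δ')`** copies.  CONCLUSION: the
three-stage nested mass of
`‖(R_ωᵀ M_{ω,τ} u_* + q(0)·b) − q(AᵀA) b‖ ≤ (ε + η)·‖b‖`
exceeds `1 − δ − δ'`.  Proof: `even_polynomial_svt` (matrix event, mass `> 1 − δ`) ∘
`output_error_mass_center` (vector event, mass `≥ 1 − δ'` for EVERY outcome `(ω,τ)`, its
per-outcome threshold discharged uniformly by `vector_step_threshold_of_uniform` from
`frobSq_sketch_mul_le` and `frobSq_transpose_mul_kernel_le`) ∘ `nested_mass_three_stage`.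
SCOPE (honest): finite sums of sampling weights over the cell's own sketch estimators — no
algorithm, running time or query model (`SQ` access to `y = R_ωᵀ(M u_*) + q(0)b` is the tree's
`outputWitness`, not restated); Euclidean error against `‖b‖` (the print rescales
`ε ← ε‖p(A)b‖`); Frobenius currency (the print's `‖A‖²‖A‖_F²`, `‖A‖⁶‖A‖_F²` as `‖A‖_F`-powers, as
in the host theorems); the `σ`-threshold has degree exponent `4` where the print's operator-norm
route has `2` — the typed residue of the module docstring and `vector_stage_sample_display`.
Nothing here bears on BQP vs BPP.
[cite: ChiaEtAl2022, §3.3 Theorem 3.4 (even case) and its proof (held arXiv text p. 20 L65 –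
p. 21 L22: "… We further approximate `Rb ≈ u` … As a consequence, `v := R†f̄(CC†)u + f(0)b`
satisfies `‖v − p(A)b‖ ≤ ε`"); Minsker2015, §3 Remark 3.2 (the selection behind `t`)] -/
theorem even_polynomial_svt_end_to_end (W : MatrixOversamplingWitness φ A) (hA : A ≠ 0)
    (hA1 : ∀ x ∈ spectrum ℝ (Aᵀ * A), x ≤ 1) (hs : 0 < s) (hc : 0 < c) {δ ε : ℝ}
    (hδ : 0 < δ) (hδ1 : δ ≤ 1) (hε : 0 < ε) {k : ℕ} (q : ℝ[X]) (hq : q.natDegree ≤ k)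
    (hq1 : ∀ y ∈ Set.Icc (0 : ℝ) 1, |q.eval y| ≤ 1)
    (hsL : 8 * φ ^ 2 * (2 * k) ^ 4 * frobSq A ^ 2 * Real.log (6 / δ) / ε ^ 2 ≤ s)
    (hs3 : 2 * φ ^ 2 * Real.log (3 / δ) ≤ s)
    (hcL : 8 * φ ^ 6 * (2 * k) ^ 8 * frobSq A ^ 4 * Real.log (6 / δ) / ε ^ 2 ≤ c)
    {φb : ℝ} {b : Fin n → ℝ} (wb : OversamplingWitness φb b) (hb : b ≠ 0) (hσ : 0 < σ)
    {η δ' : ℝ} (hη : 0 < η) (hδ' : 0 < δ')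
    (hσL : 144 * φ ^ 2 * φb * (k : ℝ) ^ 4 * frobSq A ^ 2 / η ^ 2 ≤ σ)
    (ht : 0 < t) (htδ : 8 * Real.log (1 / δ') ≤ t)
    (sel : (Fin s → Fin m) → (Fin t → (Fin σ → Fin n)) → Fin t)
    (hsel : ∀ ω ξ, IsCenter Output.vecDist (fun i =>
      Output.matVecEst (sketch (rowDist W.tilde) ω * A) b (lengthSqDist wb.tilde) (ξ i))
      (sel ω ξ)) :
    1 - δ - δ' <
      ∑ ω : Fin s → Fin m, iidWeight (rowDist W.tilde) ω *
        ∑ τ : Fin c → Fin n, iidWeight (rowDist (sketch (rowDist W.tilde) ω * W.tilde)ᵀ) τ *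
          ∑ ξ ∈ univ.filter (fun ξ : Fin t → (Fin σ → Fin n) =>
            Real.sqrt (normSq ((sketch (rowDist W.tilde) ω * A)ᵀ *ᵥ
                (cfc (qbarClamp q) ((sketch (rowDist (sketch (rowDist W.tilde) ω * W.tilde)ᵀ) τ *
                    (sketch (rowDist W.tilde) ω * A)ᵀ)ᵀ *
                  (sketch (rowDist (sketch (rowDist W.tilde) ω * W.tilde)ᵀ) τ *
                    (sketch (rowDist W.tilde) ω * A)ᵀ)) *ᵥ
                  Output.matVecEst (sketch (rowDist W.tilde) ω * A) b (lengthSqDist wb.tilde)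
                    (ξ (sel ω ξ))) +
                (q.eval 0) • b - (aeval (Aᵀ * A) q) *ᵥ b)) ≤
              (ε + η) * Real.sqrt (normSq b)),
            iidWeight (iidWeight (lengthSqDist wb.tilde)) ξ := by
  classical
  have key := even_polynomial_svt W hA hA1 hs hc hδ hδ1 hε q hq hq1 hsL hs3 hcL
  have hφ : 0 < φ := W.pos hA
  have hφb : 0 < φb := wb.pos hb
  have hdistA := W.isOversampledDist_rowDist hA
  have hdistb := wb.isOversampledDist hb
  have hw₁ : ∀ ω : Fin s → Fin m, 0 ≤ iidWeight (rowDist W.tilde) ω :=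
    iidWeight_nonneg hdistA.nonneg
  have hw₂ : ∀ (ω : Fin s → Fin m) (τ : Fin c → Fin n),
      0 ≤ iidWeight (rowDist (sketch (rowDist W.tilde) ω * W.tilde)ᵀ) τ := fun ω =>
    iidWeight_nonneg fun i => div_nonneg (normSq_nonneg _) (frobSq_nonneg _)
  have hw₃ : ∀ ξ : Fin t → (Fin σ → Fin n), 0 ≤ iidWeight (iidWeight (lengthSqDist wb.tilde)) ξ :=
    iidWeight_nonneg (iidWeight_nonneg hdistb.nonneg)
  -- stage (3) for EVERY outcome `(ω, τ)`: the boosted vector step at the uniform threshold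
  -- (`‖R_ω‖_F² ≤ φ‖A‖_F²`, `‖R_ωᵀM‖_F² ≤ (2k²)²‖R_ω‖_F²`); then nest, and on the matrix event the
  -- vector event implies the end-to-end event
  refine nested_mass_three_stage hw₁ hw₂ hw₃ hδ hδ'.le key
    (fun ω τ _ => Output.output_error_mass_center wb hb hσ (sketch (rowDist W.tilde) ω * A)
      (cfc (qbarClamp q) ((sketch (rowDist (sketch (rowDist W.tilde) ω * W.tilde)ᵀ) τ *
          (sketch (rowDist W.tilde) ω * A)ᵀ)ᵀ * (sketch (rowDist (sketch (rowDist W.tilde) ω *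
          W.tilde)ᵀ) τ * (sketch (rowDist W.tilde) ω * A)ᵀ)))
      (aeval (Aᵀ * A) q) (q.eval 0) hη hδ'
      (vector_step_threshold_of_uniform hφb.le hη (frobSq_sketch_mul_le hdistA hφ ω)
        (frobSq_transpose_mul_kernel_le hq hq1 _ _) hσL) ht htδ (sel ω) (hsel ω))
    (fun ω τ hτ => ?_)
  intro ξ hξ
  rw [mem_filter] at hτ hξ ⊢
  refine ⟨mem_univ _, hξ.2.trans ?_⟩
  rw [add_mul]
  exact add_le_add (mul_le_mul_of_nonneg_right hτ.2 (Real.sqrt_nonneg _)) le_rfl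

/-- **Corollary (the print's normalisation `‖A‖_F ≤ 1`).**  Under Theorem 3.4's standing
hypothesis `‖A‖_F = 1` (here `‖A‖_F² ≤ 1`) the spectral hypothesis is automatic and every
threshold is a polynomial in `d = 2k`, `φ`, `φ_b`, `1/ε`, `1/η`, `log(1/δ)`, `log(1/δ')` alone:
`s ≥ 8φ²(2k)⁴log(6/δ)/ε²`, `s ≥ 2φ²log(3/δ)`, `c ≥ 8φ⁶(2k)⁸log(6/δ)/ε²`,
`σ ≥ 144φ²φ_b k⁴/η²`, `t ≥ 8 ln(1/δ')`. [cite: ChiaEtAl2022, §3.3 Theorem 3.4 (even case,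
"`‖A‖_F = 1`") and its proof (held arXiv text p. 20 L65 – p. 21 L22)] -/
theorem even_polynomial_svt_end_to_end_normalised (W : MatrixOversamplingWitness φ A)
    (hA : A ≠ 0) (hF : frobSq A ≤ 1) (hs : 0 < s) (hc : 0 < c) {δ ε : ℝ}
    (hδ : 0 < δ) (hδ1 : δ ≤ 1) (hε : 0 < ε) {k : ℕ} (q : ℝ[X]) (hq : q.natDegree ≤ k)
    (hq1 : ∀ y ∈ Set.Icc (0 : ℝ) 1, |q.eval y| ≤ 1)
    (hsL : 8 * φ ^ 2 * (2 * k) ^ 4 * Real.log (6 / δ) / ε ^ 2 ≤ s)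
    (hs3 : 2 * φ ^ 2 * Real.log (3 / δ) ≤ s)
    (hcL : 8 * φ ^ 6 * (2 * k) ^ 8 * Real.log (6 / δ) / ε ^ 2 ≤ c)
    {φb : ℝ} {b : Fin n → ℝ} (wb : OversamplingWitness φb b) (hb : b ≠ 0) (hσ : 0 < σ)
    {η δ' : ℝ} (hη : 0 < η) (hδ' : 0 < δ')
    (hσL : 144 * φ ^ 2 * φb * (k : ℝ) ^ 4 / η ^ 2 ≤ σ)
    (ht : 0 < t) (htδ : 8 * Real.log (1 / δ') ≤ t)
    (sel : (Fin s → Fin m) → (Fin t → (Fin σ → Fin n)) → Fin t)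
    (hsel : ∀ ω ξ, IsCenter Output.vecDist (fun i =>
      Output.matVecEst (sketch (rowDist W.tilde) ω * A) b (lengthSqDist wb.tilde) (ξ i))
      (sel ω ξ)) :
    1 - δ - δ' <
      ∑ ω : Fin s → Fin m, iidWeight (rowDist W.tilde) ω *
        ∑ τ : Fin c → Fin n, iidWeight (rowDist (sketch (rowDist W.tilde) ω * W.tilde)ᵀ) τ *
          ∑ ξ ∈ univ.filter (fun ξ : Fin t → (Fin σ → Fin n) =>
            Real.sqrt (normSq ((sketch (rowDist W.tilde) ω * A)ᵀ *ᵥ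
                (cfc (qbarClamp q) ((sketch (rowDist (sketch (rowDist W.tilde) ω * W.tilde)ᵀ) τ *
                    (sketch (rowDist W.tilde) ω * A)ᵀ)ᵀ *
                  (sketch (rowDist (sketch (rowDist W.tilde) ω * W.tilde)ᵀ) τ *
                    (sketch (rowDist W.tilde) ω * A)ᵀ)) *ᵥ
                  Output.matVecEst (sketch (rowDist W.tilde) ω * A) b (lengthSqDist wb.tilde)
                    (ξ (sel ω ξ))) +
                (q.eval 0) • b - (aeval (Aᵀ * A) q) *ᵥ b)) ≤
              (ε + η) * Real.sqrt (normSq b)),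
            iidWeight (iidWeight (lengthSqDist wb.tilde)) ξ := by
  have hF0 : 0 ≤ frobSq A := frobSq_nonneg A
  have hℓ : 0 ≤ Real.log (6 / δ) := Real.log_nonneg (by rw [le_div_iff₀ hδ]; linarith)
  have hφ : 0 < φ := W.pos hA
  have hφb : 0 < φb := wb.pos hb
  have hF2 : frobSq A ^ 2 ≤ 1 := pow_le_one₀ hF0 hF
  have hF4 : frobSq A ^ 4 ≤ 1 := pow_le_one₀ hF0 hF
  refine even_polynomial_svt_end_to_end W hA (fun x hx => (spectrum_gram_le_frobSq' A hx).trans hF)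
    hs hc hδ hδ1 hε q hq hq1 (le_trans ?_ hsL) hs3 (le_trans ?_ hcL) wb hb hσ hη hδ'
    (le_trans ?_ hσL) ht htδ sel hsel
  · have h0 : 0 ≤ 8 * φ ^ 2 * (2 * (k : ℝ)) ^ 4 * Real.log (6 / δ) / ε ^ 2 := by positivity
    calc 8 * φ ^ 2 * (2 * (k : ℝ)) ^ 4 * frobSq A ^ 2 * Real.log (6 / δ) / ε ^ 2
        = 8 * φ ^ 2 * (2 * (k : ℝ)) ^ 4 * Real.log (6 / δ) / ε ^ 2 * frobSq A ^ 2 := by ring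
      _ ≤ 8 * φ ^ 2 * (2 * (k : ℝ)) ^ 4 * Real.log (6 / δ) / ε ^ 2 := mul_le_of_le_one_right h0 hF2
  · have h0 : 0 ≤ 8 * φ ^ 6 * (2 * (k : ℝ)) ^ 8 * Real.log (6 / δ) / ε ^ 2 := by positivity
    calc 8 * φ ^ 6 * (2 * (k : ℝ)) ^ 8 * frobSq A ^ 4 * Real.log (6 / δ) / ε ^ 2
        = 8 * φ ^ 6 * (2 * (k : ℝ)) ^ 8 * Real.log (6 / δ) / ε ^ 2 * frobSq A ^ 4 := by ring
      _ ≤ 8 * φ ^ 6 * (2 * (k : ℝ)) ^ 8 * Real.log (6 / δ) / ε ^ 2 := mul_le_of_le_one_right h0 hF4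
  · have h0 : 0 ≤ 144 * φ ^ 2 * φb * (k : ℝ) ^ 4 / η ^ 2 := by positivity
    calc 144 * φ ^ 2 * φb * (k : ℝ) ^ 4 * frobSq A ^ 2 / η ^ 2
        = 144 * φ ^ 2 * φb * (k : ℝ) ^ 4 / η ^ 2 * frobSq A ^ 2 := by ring
      _ ≤ 144 * φ ^ 2 * φb * (k : ℝ) ^ 4 / η ^ 2 := mul_le_of_le_one_right h0 hF2

/-! ### §5 The displayed count of the vector stage, beside the print's -/

/-- **Display (vector stage, degree exponent 4 in this currency).**  At the thresholds of
`even_polynomial_svt_end_to_end`, `σ = 144φ²φ_b k⁴F²/η² = 9φ²φ_b d⁴F²/η²` per copy (`d = 2k`,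
`F = ‖A‖_F²`) and `t = 8ℓ'` copies (`ℓ' = ln(1/δ')`), the vector stage draws
`t·σ = 72 φ²φ_b d⁴ F² ℓ'/η²` samples of `SQ(b)` — degree exponent `4`.  The print's count for the
same step is `≍ φ‖A‖_F²‖b‖²d²/ε²` (degree exponent `2`; absolute error `ε`, here `η‖b‖`), reached
through the operator-norm inequality `‖R†√f̄(CC†)‖² ≤ ‖f(A†A) − f(0)I‖ + ε ≤ 2` that the
Frobenius surrogate `frobSq_mul_cfc_le` cannot see: THAT inequality is the typed residue.  Both
counts are subdominant to the stage-(2) sketch, `s·c = 2⁶φ⁸d¹²F⁶ℓ²/ε⁴` entries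
(`threshold_entry_count_display`).  An arithmetic identity; no query or time model is
formalised. [cite: ChiaEtAl2022, §3.3 proof of Theorem 3.4 (even case: "Using (prop:appr-mms),
this needs `Õ(‖A‖_F²‖b‖² d²/ε² …)` samples", held arXiv text p. 21 L12–13)] -/
theorem vector_stage_sample_display (φ φb d F η ℓ' : ℝ) :
    8 * ℓ' * (144 * φ ^ 2 * φb * (d / 2) ^ 4 * F ^ 2 / η ^ 2) =
      72 * φ ^ 2 * φb * d ^ 4 * F ^ 2 * ℓ' / η ^ 2 := by
  ring

end endToEnd

end Literature.Computability.QuantumComplexity.SampleQuery.EvenPolySVT
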